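import Summits.ResolutionOfSingularities.ResolutionOfSingularities.Theorems.FrobeniusClosingPatchingRelPerfectDepthGradedFormatMono
import Literature.AlgebraicGeometry.Resolution.MarkedIdealsArithmetic
import HarnessLib

/-!
# Crux `PatchingRelPerfect` (stmt-ResolutionOfSingularities-16161), chain W5.2 — rung R4ˢ-general, X-side:
# the GLOBAL HOST FORMAT WITH MONOMIAL `K = 𝓗 ⊔ N · 𝓘_E^ℓ` and its (retraction-free) propagation

[OURS · L1 W5.2 · rung tool] Replaces the role of NO printed item; NOT a statement of the manuscript under review;
fact-free. The retraction model `GradedFormatMono` (`…DepthGradedFormatMono.lean`, p505368) controls the residual `K`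
only on a neighbourhood `V` of the strict transform of `E` — enough for the PERMISSIBILITY TRANSFER, not for the END
phase, whose cosupport escapes `V` after every deficient-weight step (kernel sentence v1.6). The END phase wants a
GLOBAL expression of `K` as a SUM OF TWO MONOMIALS, so that res-L1-w52-stub-4's two-monomial principalization
(`DepthTargets.monomialSumPrincipalization_of_length_le_two`, p504028) can finish near `E'`, on every escaped pocket and
at the corners AT ONCE (res-L1-w52-tri-1 TRIAGE v8 (L2) is the pocketwise form). This file supplies the global
format and shows that it costs nothing to carry:

* `HostMonoFormat ℓ i K 𝓗 N` := `𝓗` is an effective Cartier ideal (the «host»: exceptional monomial times the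
  strict transform of the member's hypersurface) and `K = 𝓗 ⊔ N · (ker i)^ℓ` GLOBALLY (type-049's host format
  `K = H ⊔ 𝓘_E²` is `N = ⊤`, `ℓ = 2`).
* **`HostMonoFormat.step`** — PROPAGATION through EVERY weight-`ν ≤ ℓ` step with X-side permissibility
  `K ≤ Ĉ^ν` (no retraction, no format near `E` needed): `σᶜ(𝓗 ⊔ N·𝓘_E^ℓ, ν) = σᶜ(𝓗, ν) ⊔ σ^*N·𝓘_{exc}^{ℓ-ν}·𝓘_{E'}^ℓ`
  by the SUM and PRODUCT rules for controlled transforms (BGMW Lemma 3.7.1, tree `controlledTransform_sup` /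
  `controlledTransform_mul`) and `𝓘_E𝒪 = 𝓘_{exc}·𝓘_{E'}` (`IsBlowup.ker_strictTransformHom_of_isRegular`);
  `σᶜ(𝓗, ν)` is again effective Cartier (cancel `𝓘_{exc}^ν` in `σ^*𝓗`).
* `GradedHostMonoP ℓ` := `GradedMonoP ℓ` ∧ `∃ 𝓗, HostMonoFormat ℓ i K 𝓗 N`; **`stepMixed_gradedHostMono`**,
  **`towerMixed_gradedHostMono`** (`StepMixed` / `TowerMixed` of `…DepthMixedTower.lean`, p504758) and the unpacked
  **`HostMonoFormat.tower`**: along any weighted E-side sequence (W₂'s output for `ℓ = 2`) BOTH formats travel —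
  the local one transfers permissibility, the global one books the end state `K' = 𝓗' ⊔ N'·𝓘_{E'}^ℓ` on all of `X'`.

## References
* E. Bierstone, D. Grigoriev, P. Milman, J. Włodarczyk, arXiv:1206.3090, §3.2 Lemma 3.2.1, §3.7 Lemma 3.7.1, §4 Remark (3).
  [BierstoneGrigorievMilmanWlodarczyk2011]
* U. Görtz, T. Wedhorn, *Algebraic Geometry I*, 2nd ed. (2020), Prop. 13.91 (1), Prop. 13.96 (2). [GortzWedhorn2020]
* J. Kollár, *Lectures on Resolution of Singularities* (2007), (3.111) Step 3. [Kollar2007]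
-/

-- `Summit.<Summit>.<Sub>.Theorems` with `Sub = Summit` (single-conjunct summit, D-0017)
set_option linter.dupNamespace false

noncomputable section

open CategoryTheory CategoryTheory.Limits AlgebraicGeometry TopologicalSpace
open Literature.AlgebraicGeometry.Resolution
open Scheme.IdealSheafData

namespace Summit.ResolutionOfSingularities.ResolutionOfSingularities.Theorems

universe u

namespace DepthGraded

/-! ## §1 The global host format with monomial -/

/-- [OURS · L1 W5.2] **Host format with monomial, weight `ℓ`**: `𝓗` is an effective Cartier ideal sheaf on `X` and
`K = 𝓗 ⊔ N · (ker i)^ℓ` globally. [cite: BierstoneGrigorievMilmanWlodarczyk2011, §3.7 Lemma 3.7.1]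
[cite: Kollar2007, (3.111) Step 3] -/
def HostMonoFormat (ℓ : ℕ) {E X : Scheme.{u}} (i : E ⟶ X) (K 𝓗 N : X.IdealSheafData) : Prop :=
  IsEffectiveCartier 𝓗 ∧ K = 𝓗 ⊔ N * i.ker ^ ℓ

namespace HostMonoFormat

variable {ℓ : ℕ} {E X : Scheme.{u}} {i : E ⟶ X} {K 𝓗 N : X.IdealSheafData}

/-- The host is contained in the residual. [folklore] -/
theorem host_le (h : HostMonoFormat ℓ i K 𝓗 N) : 𝓗 ≤ K := by
  rw [h.2]; exact le_sup_left

/-- Monomial contact: `N · (ker i)^ℓ ≤ K`. [folklore] -/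
theorem mul_ker_pow_le (h : HostMonoFormat ℓ i K 𝓗 N) : N * i.ker ^ ℓ ≤ K := by
  rw [h.2]; exact le_sup_right

/-- [OURS · L1 W5.2] **The weight-`ν` controlled transform of `𝓘_E^ℓ`** along the blow-up of a regular centre inside
the regular hypersurface `E` of the regular `X`: `σᶜ(𝓘_E^ℓ, ν) = 𝓘_{exc}^{ℓ-ν} · 𝓘_{E'}^ℓ`, `E'` the strict transform
(`𝓘_E𝒪 = 𝓘_{exc}·𝓘_{E'}`, then cancel `𝓘_{exc}^ν`). [cite: BierstoneGrigorievMilmanWlodarczyk2011, §4 Remark (3) with §3.2 Lemma 3.2.1]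
[cite: GortzWedhorn2020, Prop. 13.96 (2)] -/
theorem controlledTransform_ker_pow [IsLocallyNoetherian X] [IsClosedImmersion i] (hX : Scheme.IsRegular X)
    (hE : Scheme.IsRegular E) {C : E.IdealSheafData} (hC : Scheme.IsRegular C.subscheme) {ν : ℕ} (hνℓ : ν ≤ ℓ)
    {X' E' : Scheme.{u}} {σ : X' ⟶ X} {τ : E' ⟶ E} (hσ : IsBlowup σ (C.map i))
    (hτ' : IsBlowup τ ((C.map i).comap i)) :
    controlledTransform σ (C.map i) (i.ker ^ ℓ) ν =
      (C.map i).comap σ ^ (ℓ - ν) * (hσ.strictTransformHom hτ').ker ^ ℓ := by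
  set Ch : X.IdealSheafData := C.map i with hCh
  have hkerCh : i.ker ≤ Ch := DepthOne.ker_le_map_centre i C
  have hChreg : Scheme.IsRegular Ch.subscheme := DepthOne.isRegular_subscheme_map i C hC
  have hexc : IsEffectiveCartier (Ch.comap σ) := hσ.isEffectiveCartier
  have hker : (hσ.strictTransformHom hτ').ker = controlledTransform σ Ch i.ker 1 :=
    hσ.ker_strictTransformHom_of_isRegular hX hChreg hτ' hkerCh (DepthOne.isRegular_subscheme_ker i hE)
  have hkerfac : Ch.comap σ * (hσ.strictTransformHom hτ').ker = i.ker.comap σ := by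
    rw [hker]; exact hσ.comap_mul_controlledTransform_one hkerCh
  have hle : (i.ker ^ ℓ).comap σ ≤ Ch.comap σ ^ ν := by
    rw [comap_pow, ← hkerfac, mul_pow]
    exact (mul_le_of_le_one_right' le_top).trans (pow_le_pow_right_of_le_one' le_top hνℓ)
  apply (hexc.pow ν).eq_of_mul_eq_mul
  rw [hσ.pow_mul_controlledTransform_eq hle, comap_pow, ← hkerfac, mul_pow, ← mul_assoc, ← pow_add,
    Nat.add_sub_cancel' hνℓ]

/-- [OURS · L1 W5.2] **PROPAGATION of the host format with monomial through a weight-`ν` step** (retraction-free):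
`X` regular locally Noetherian, `E` regular, `i : E ⟶ X` a closed immersion, `HostMonoFormat ℓ i K 𝓗 N`, `C ⊆ E` a
regular centre, X-side permissibility `K ≤ Ĉ^ν` with `ν ≤ ℓ` (`Ĉ = C.map i`), `σ` a blow-up along `Ĉ`, `τ` a blow-up
of `E` along `C`, `i' : E' ⟶ X'` with `i' ≫ σ = τ ≫ i`. Then
`HostMonoFormat ℓ i' (σᶜ(K, ν)) (σᶜ(𝓗, ν)) (σ^*N · 𝓘_{exc}^{ℓ-ν})` — the sum rule splits `σᶜ(K, ν)`, the product rule
and `controlledTransform_ker_pow` compute the monomial summand, and `σᶜ(𝓗, ν)` is effective Cartier by cancelling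
`𝓘_{exc}^ν` in `σ^*𝓗`. [cite: BierstoneGrigorievMilmanWlodarczyk2011, §3.7 Lemma 3.7.1 (1)–(2)]
[cite: GortzWedhorn2020, Prop. 13.91 (1), Prop. 13.96 (2)] -/
theorem step [IsLocallyNoetherian X] [IsClosedImmersion i] (hX : Scheme.IsRegular X) (hE : Scheme.IsRegular E)
    (h : HostMonoFormat ℓ i K 𝓗 N) {C : E.IdealSheafData} {ν : ℕ} (hνℓ : ν ≤ ℓ)
    (hC : Scheme.IsRegular C.subscheme) (hKC : K ≤ (C.map i) ^ ν)
    {X' E' : Scheme.{u}} {σ : X' ⟶ X} {τ : E' ⟶ E} (hσ : IsBlowup σ (C.map i)) (hτ : IsBlowup τ C)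
    {i' : E' ⟶ X'} (hsq : i' ≫ σ = τ ≫ i) :
    HostMonoFormat ℓ i' (controlledTransform σ (C.map i) K ν) (controlledTransform σ (C.map i) 𝓗 ν)
      (N.comap σ * (C.map i).comap σ ^ (ℓ - ν)) := by
  set Ch : X.IdealSheafData := C.map i with hCh
  have hexc : IsEffectiveCartier (Ch.comap σ) := hσ.isEffectiveCartier
  -- `τ` as the blow-up along `Ĉ|_E`, and `i'` IS the strict-transform morphism (universal property)
  have hτ' : IsBlowup τ (Ch.comap i) := by rw [hCh, DepthOne.comap_map_centre]; exact hτ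
  have hi' : i' = hσ.strictTransformHom hτ' := by
    apply hσ.hom_ext
    · rw [hsq, Scheme.IdealSheafData.comap_comp, hCh, DepthOne.comap_map_centre]
      exact hτ.isEffectiveCartier
    · rw [hsq, hσ.strictTransformHom_comp hτ']
  -- divisibility of the summands upstairs
  haveI : IsProper σ := hσ.isProper
  haveI : IsLocallyNoetherian X' := LocallyOfFiniteType.isLocallyNoetherian σ
  have hKσ : K.comap σ ≤ Ch.comap σ ^ ν := by
    have h1 : K.comap σ ≤ (Ch ^ ν).comap σ := Scheme.IdealSheafData.comap_mono (f := σ) hKC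
    rwa [comap_pow] at h1
  have h𝓗σ : 𝓗.comap σ ≤ Ch.comap σ ^ ν := (Scheme.IdealSheafData.comap_mono (f := σ) h.host_le).trans hKσ
  have hMσ : (N * i.ker ^ ℓ).comap σ ≤ Ch.comap σ ^ ν :=
    (Scheme.IdealSheafData.comap_mono (f := σ) h.mul_ker_pow_le).trans hKσ
  have hNσ : N.comap σ ≤ Ch.comap σ ^ 0 := by
    rw [pow_zero, Scheme.IdealSheafData.one_eq_top]; exact le_top
  have hkerσ : (i.ker ^ ℓ).comap σ ≤ Ch.comap σ ^ ν := by
    have h1 : i.ker ^ ℓ ≤ Ch ^ ν :=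
      (pow_le_pow_left' (DepthOne.ker_le_map_centre i C) ℓ).trans (pow_le_pow_right_of_le_one' le_top hνℓ)
    have h2 : (i.ker ^ ℓ).comap σ ≤ (Ch ^ ν).comap σ := Scheme.IdealSheafData.comap_mono (f := σ) h1
    rw [comap_pow σ Ch ν] at h2
    exact h2
  -- the monomial summand transforms to `σ^*N · 𝓘_{exc}^{ℓ-ν} · 𝓘_{E'}^ℓ`
  have hkp := controlledTransform_ker_pow (ℓ := ℓ) hX hE hC hνℓ hσ hτ'
  rw [← hi'] at hkp
  have hmul := controlledTransform_mul hexc hNσ hkerσ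
  rw [zero_add, controlledTransform_zero, hkp] at hmul
  obtain ⟨h𝓗, hK⟩ := h
  refine ⟨?_, ?_⟩
  · -- `σᶜ(𝓗, ν)` is effective Cartier: cancel `𝓘_{exc}^ν` in `σ^*𝓗`
    have h2 : IsEffectiveCartier (𝓗.comap σ) := h𝓗.comap_of_isBlowup hσ
    rw [← hσ.pow_mul_controlledTransform_eq h𝓗σ] at h2
    exact h2.of_mul_right
  · -- the format: sum rule, then the monomial summand
    rw [hK, controlledTransform_sup hexc h𝓗σ hMσ, hmul, mul_assoc]

end HostMonoFormat

/-! ## §2 Both formats along the mixed tower -/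

/-- [OURS · L1 W5.2] The joint format predicate: graded-with-monomial near `E` (for the TRANSFER) AND host-with-monomial
globally (for the END). -/
def GradedHostMonoP (ℓ : ℕ) : ∀ ⦃E X : Scheme.{u}⦄, (E ⟶ X) → X.IdealSheafData → X.IdealSheafData → Prop :=
  fun _ _ i K N => GradedFormatMono ℓ i K (K.comap i) N ∧ ∃ 𝓗, HostMonoFormat ℓ i K 𝓗 N

/-- [OURS · L1 W5.2] **The formatted MIXED STEP carrying both formats**: transfer from the graded format
(`GradedFormatMono.le_map_pow`), propagation of the graded format (`GradedFormatMono.step`) and of the host format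
(`HostMonoFormat.step`, with `𝓗' = σᶜ(𝓗, ν)`). [cite: BierstoneGrigorievMilmanWlodarczyk2011, §3.2 Lemma 3.2.1, §3.7 Lemma 3.7.1] -/
theorem stepMixed_gradedHostMono (ℓ : ℕ) : DepthTargets.StepMixed ℓ (GradedHostMonoP.{u} ℓ) := by
  refine DepthTargets.stepMixed_of_transfer_of_propagate ?_ ?_
  · intro S _ _ I E X i g K N hinv hP C ν hC _ hνℓ hle
    haveI := hinv.isClosedImmersion
    exact GradedFormatMono.le_map_pow hP.1 hνℓ hle
  · intro S _ _ I E X i g K N hinv hP E' τ C ν hC _ hνℓ hle hτ X' σ i' hσ hsq hinv' hK'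
    haveI := hinv.isNoetherian
    haveI := hinv.isClosedImmersion
    obtain ⟨hgr, 𝓗, hhost⟩ := hP
    have hperm : K ≤ (C.map i) ^ ν := GradedFormatMono.le_map_pow hgr hνℓ hle
    refine ⟨?_, controlledTransform σ (C.map i) 𝓗 ν,
      hhost.step hinv.isRegular hinv.isRegular_exc hνℓ hC hperm hσ hτ hsq⟩
    have h := GradedFormatMono.step hinv.isRegular hinv.isRegular_exc hgr hνℓ hC hle hσ hτ hsq
    change GradedFormatMono ℓ i' _ _ _
    rw [hK']
    exact h

/-- [OURS · L1 W5.2] **The MIXED TOWER carrying both formats** (`towerMixed_of_stepMixed`).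
[cite: Kollar2007, (3.111) Step 3] [cite: BierstoneGrigorievMilmanWlodarczyk2011, Def. 3.1.3, §3.2] -/
theorem towerMixed_gradedHostMono (ℓ : ℕ) : DepthTargets.TowerMixed ℓ (GradedHostMonoP.{u} ℓ) :=
  DepthTargets.towerMixed_of_stepMixed (stepMixed_gradedHostMono ℓ)

/-- [OURS · L1 W5.2] **The mixed tower with the GLOBAL END BOOKKEEPING, unpacked.** From a state of the
monomial-contact invariant whose residual is graded-with-monomial near `E` AND host-with-monomial globally
(`K = 𝓗 ⊔ N·𝓘_E^ℓ`, `𝓗` effective Cartier), every weighted E-side sequence (weights `≤ ℓ`) lifts to the ambient scheme,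
and at the end `K' = 𝓗' ⊔ N'·𝓘_{E'}^ℓ` GLOBALLY on `X'` with `𝓗'` effective Cartier, `N'` the exceptional monomial,
besides the invariant, `K'|_{E'} = 𝔟'` and the graded format — the input of a two-monomial END
(`DepthTargets.monomialSumPrincipalization_of_length_le_two`) once `{𝓗'_red, E', carriers of N'}` is an snc family.
[cite: Kollar2007, (3.111) Step 3] [cite: BierstoneGrigorievMilmanWlodarczyk2011, §3.7 Lemma 3.7.1] -/
theorem HostMonoFormat.tower {ℓ : ℕ} {S : Type u} [CommRing S] [IsRegularLocalRing S] {I : Ideal S}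
    {E X : Scheme.{u}} {i : E ⟶ X} {g : X ⟶ Spec (.of S)} {K 𝓗 N : X.IdealSheafData}
    (hinv : DepthTargets.DepthInvariantMono ℓ S I E X i g K N) (hgr : GradedFormatMono ℓ i K (K.comap i) N)
    (hhost : HostMonoFormat ℓ i K 𝓗 N)
    {E' : Scheme.{u}} {ρ : E' ⟶ E} {𝔟' : E'.IdealSheafData}
    (hseq : DepthTargets.IsWeightedSeq ℓ ρ (K.comap i) 𝔟') :
    ∃ (X' : Scheme.{u}) (π : X' ⟶ X) (i' : E' ⟶ X') (K' N' 𝓗' : X'.IdealSheafData),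
      DepthTargets.IsWeightedSeq ℓ π K K' ∧ i' ≫ π = ρ ≫ i ∧
      DepthTargets.DepthInvariantMono ℓ S I E' X' i' (π ≫ g) K' N' ∧ K'.comap i' = 𝔟' ∧
      GradedFormatMono ℓ i' K' (K'.comap i') N' ∧ HostMonoFormat ℓ i' K' 𝓗' N' := by
  obtain ⟨X', π, i', K', N', hX, hsq, hinv', hK', hgr', 𝓗', hhost'⟩ :=
    towerMixed_gradedHostMono ℓ S I E X i g K N hinv ⟨hgr, 𝓗, hhost⟩ E' ρ 𝔟' hseq
  exact ⟨X', π, i', K', N', 𝓗', hX, hsq, hinv', hK', hgr', hhost'⟩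

end DepthGraded

end Summit.ResolutionOfSingularities.ResolutionOfSingularities.Theorems

end
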